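/-
Copyright: the b2b-balaban cell (near-miss cell 7), T⁴-continuum fan-out, NE7b ROUND-2 swarm seat
`t4-ne7b-formalise-leaf-06` (row S5 of the lineage `t4-ne7b-p1` claim table `LEAVES-NE7b.md`).
Released under the licence of the surrounding project.
-/
import Summits.QuantumFields.BalabanUV.T4Continuum.Support.HistoryChrono
import Summits.QuantumFields.BalabanUV.T4Continuum.Support.HistoryAdmissible
import Literature.MathematicalPhysics.QuantumFieldTheory.Balaban1983to89.T4CanonicalMenus
import Summits.QuantumFields.BalabanUV.T4Continuum.Support.HistoryChronoAdmissible

/-!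
# History chronology for the canonical run (leaf H2c on the TH route): `T4CanonicalMenus.Chrono` vs `ZoneSkeleton.Chrono`

Summits-side support leaf of the T⁴-continuum cell (rung (B)+1 on a FINITE torus only; NOT infinite volume, NOT the
mass gap, NOT the Clay statement; NOT a proof of the spine estimate NE7b).  Row S5 «H2c chronology» of the ROUND-2 swarm
table `t4/b2b-balaban-t4-ne7b-p1/LEAVES-NE7b.md`, third file, written for the owner's ruling R-OWNER-22-1 (journal
l.5864): the COUNT assembly now targets the TH exit `CountThresholdExit.relWeightBound_lateMergers_of_irThreshold`, whose
slot-family membership `T4CanonicalMenus.mem_canonFam_of_chrono` asks, per live TAGGED genealogy `G′`, the CANONICAL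
RUN's chronology `T4CanonicalMenus.Chrono (PEv.step ∘ sh) G′` — while the zone multiplicity
(`ZoneReading.card_admZSet_le_of_reading`) asks `ZoneSkeleton.Chrono PEv.step` of its shape.  [folklore] finite
combinatorics over the lineage's OWN carriers; nothing quoted from print, nothing printed asserted, no `[cite:]` tag; the
two `def`s are decidable structural predicates ∕ data on the owner's skeleton `HistoryAdmissible.PGen` (no `Prop` fact,
trigger condition c1).

WHAT.  §1 (carrier-generic) the two chronologies compared: `maxStep_le_iff` (`T4CanonicalMenus.maxStep st G ≤ n ↔
HistoryChrono.EventsLE st n G`), **`timely_of_canon`** and **`chrono_of_canon`**: the canonical run's chronology IMPLIES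
`Timely`, hence `ZoneSkeleton.Chrono` — so ONE chronology field in the TH socket (`T4CanonicalMenus.Chrono (PEv.step ∘
sh) G′`, ruling R2) serves BOTH consumers (`chronoZ_shape_of_canon` transports it to the shape
`relabel f G′` for any step-preserving `f`); `staged_of_canon`.  The converse fails: the canonical chronology also ORIENTS
every merger (older line first) and dates it STRICTLY after the older root's birth (§3).  §2 on the owner's skeleton:
the orientation-and-strictness predicate **`CanonJoins P`** (every join lists a partner with the earliest root first,
and that root is born strictly before the join) and **`canonChrono_toGen_iff : P.Adm K → (T4CanonicalMenus.Chrono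
PEv.step P.toGen ↔ CanonJoins P)`** (`canonChrono_toGen`, `canonJoins_of_canonChrono`; `maxStep_toGen_le`).  §3 THE
LOCATED BOUNDARY (decided): the m1 join AT THE COMMON BIRTH STEP `join (birth 3 1 5) (birth 3 2 9) 3` — print's second
case with NO old constituent («some number of new large field regions joined … by the operations of the last step»,
B16 p. 386, CONTEXT) — is `Adm`, `ZoneSkeleton.Chrono` (previous file) but NOT `CanonJoins` ∕ NOT
`T4CanonicalMenus.Chrono` under ANY orientation (both roots are born at the join step): its shape is not a term of the
canonical family at its own dates.  This is the TH twin of the Z-route boundary «record steps ∈ (rootStep, K]» of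
`dictE`; HOW such all-new joins are booked (one step late, or resummed while young) is a READING decision for rows
S1b∕S3∕S12 (owner), displayed here, not made.  Orientation alone is free: `orient` (§2) swaps partners so that the older
line comes first, keeps root step ∕ last step ∕ event multiset ∕ `Adm`, and `CanonJoins (orient P) ↔ StrictJoins P`
(every join strictly after the earliest constituent birth) — so the canonical chronology of an admissible history is
available EXACTLY when no join happens at the common birth step of all its constituents.  §4 (v2, after the owner's
ruling R-OWNER-22-7 adopting (α): all-new joins are DATED ONE STEP LATE, so `StrictJoins` holds by construction)
through the shape map: **`canonChrono_of_shape`** — a tagged genealogy whose shape `relabel sh G` is the label of an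
admissible history with canonical joins is `T4CanonicalMenus.Chrono (PEv.step ∘ sh)` (the TH socket's chronology field,
per member), `canonJoins_of_shape` (converse), `chronoZ_of_shape` (the zone side of the same member).

HONEST DEPENDENCY (cell): continuum YM on T⁴ ⇐ BetaPertH ∧ nine spine estimates (0/9 proved); BetaPertH ⇐ (D1) ∧ (D4)
∧ CAP+tail.  This file changes none of it.  NE7b discharge: no date.
-/

open Finset
open Literature.MathematicalPhysics.QuantumFieldTheory.Balaban1983to89
open T4PersistenceDictionary T4BranchingRecordsGas
open Summit.QuantumFields.BalabanUV.T4Continuum.PlacementSkeleton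
open Summit.QuantumFields.BalabanUV.T4Continuum.Crowding
open Summit.QuantumFields.BalabanUV.T4Continuum.ZoneSkeleton
open Summit.QuantumFields.BalabanUV.T4Continuum.HistoryChrono
open Summit.QuantumFields.BalabanUV.T4Continuum.HistoryAdmissible

namespace Summit.QuantumFields.BalabanUV.T4Continuum.HistoryChronoCanon

/-! ## §1 The canonical run's chronology implies timeliness (carrier-generic) -/

section Generic

variable {ε δ : Type*} [DecidableEq ε] [DecidableEq δ]

/-- the canonical run's «latest step» bound is the dated-events predicate: `maxStep st G ≤ n ↔ EventsLE st n G`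
[folklore] -/
theorem maxStep_le_iff (st : ε → ℕ) (n : ℕ) : ∀ G : Gen ε, T4CanonicalMenus.maxStep st G ≤ n ↔ EventsLE st n G
  | Gen.born b j => by simp
  | Gen.renew G e h => by
      simp only [T4CanonicalMenus.maxStep_renew, max_le_iff, eventsLE_renew, maxStep_le_iff st n G, and_comm]
  | Gen.merge X Y e => by
      simp only [T4CanonicalMenus.maxStep_merge, max_le_iff, eventsLE_merge, maxStep_le_iff st n X,
        maxStep_le_iff st n Y]
      tauto

/-- **THE CANONICAL RUN'S CHRONOLOGY IMPLIES TIMELINESS** (it dates every merger no earlier than any event of either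
partner — and more). [folklore] -/
theorem timely_of_canon (st : ε → ℕ) : ∀ {G : Gen ε}, T4CanonicalMenus.Chrono st G → Timely st G
  | Gen.born _ _, _ => trivial
  | Gen.renew G e h, hc => (timely_renew st G e h).2 (timely_of_canon st hc.1)
  | Gen.merge X Y e, hc => by
      obtain ⟨hX, hY, -, -, hmX, hmY⟩ := hc
      exact (timely_merge st X Y e).2
        ⟨timely_of_canon st hX, timely_of_canon st hY, (maxStep_le_iff st _ X).1 hmX, (maxStep_le_iff st _ Y).1 hmY⟩

/-- **… HENCE `ZoneSkeleton.Chrono`**: ONE chronology field (the canonical run's) serves both the TH exit's family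
membership and the zone multiplicity count. [folklore] -/
theorem chrono_of_canon (st : ε → ℕ) {G : Gen ε} (hc : T4CanonicalMenus.Chrono st G) : Chrono st G :=
  chrono_of_timely st (timely_of_canon st hc)

/-- … and the stage invariant at the latest step [folklore] -/
theorem staged_of_canon (st : ε → ℕ) {G : Gen ε} (hc : T4CanonicalMenus.Chrono st G) :
    Staged st (T4CanonicalMenus.maxStep st G) G :=
  ⟨timely_of_canon st hc, (maxStep_le_iff st _ G).1 le_rfl⟩

omit [DecidableEq ε] in
/-- **TRANSPORT TO THE SHAPE**: the canonical chronology of a tagged genealogy read through `st ∘ f` gives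
`ZoneSkeleton.Chrono st` of its relabelling `relabel f G` (the shape the zone count sees; `T4BranchingRecordsGas.relabel`,
any `f`, no injectivity). [folklore] -/
theorem chronoZ_shape_of_canon (f : ε → δ) (st : δ → ℕ) {G : Gen ε} (hc : T4CanonicalMenus.Chrono (st ∘ f) G) :
    Chrono st (relabel f G) :=
  chrono_of_canon st ((T4CanonicalMenus.chrono_relabel_iff f (st := st ∘ f) (st' := st) (fun _ => rfl) G).2 hc)

/-- The converse of `timely_of_canon` FAILS: a timely (indeed staged) merger of two regions AT THEIR COMMON BIRTH STEP is
not chronological for the canonical run, which dates a merger strictly after the older root's birth (decided).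
[folklore] -/
theorem timely_not_canon_example :
    Timely PEv.step (Gen.merge (Gen.born ((3, 0, 1) : PEv) 3) (Gen.born (3, 0, 2) 3) (3, 2, 0)) ∧
      ¬ T4CanonicalMenus.Chrono PEv.step (Gen.merge (Gen.born ((3, 0, 1) : PEv) 3) (Gen.born (3, 0, 2) 3) (3, 2, 0)) :=
  ⟨(timely_merge PEv.step _ _ _).2
      ⟨trivial, trivial, (eventsLE_born _ _ _ _).2 (by decide), (eventsLE_born _ _ _ _).2 (by decide)⟩,
    by decide⟩

end Generic

/-! ## §2 On the owner's skeleton: orientation and strictness of the joins -/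

section Skeleton

variable {γ : Type*}

/-- **`CanonJoins P`** — the canonical run's orientation-and-strictness convention read on an admissible history: at
every join the FIRST partner carries the (weakly) earliest root, and that root is born STRICTLY before the join step.
Decidable, structural; a predicate on OUR data. [folklore] -/
def CanonJoins : PGen γ → Prop
  | PGen.birth _ _ _ => True
  | PGen.renew G _ => CanonJoins G
  | PGen.join X Y s => CanonJoins X ∧ CanonJoins Y ∧ X.rootStep ≤ Y.rootStep ∧ X.rootStep < s

/-- `CanonJoins` is decidable [folklore] -/
instance CanonJoins.instDecidable : ∀ P : PGen γ, Decidable (CanonJoins P)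
  | PGen.birth _ _ _ => isTrue trivial
  | PGen.renew G _ => CanonJoins.instDecidable G
  | PGen.join X Y s =>
      haveI := CanonJoins.instDecidable X
      haveI := CanonJoins.instDecidable Y
      inferInstanceAs (Decidable (CanonJoins X ∧ CanonJoins Y ∧ X.rootStep ≤ Y.rootStep ∧ X.rootStep < s))

/-- under `Adm` the label's latest step is at most the history's last step [folklore] -/
theorem maxStep_toGen_le {K : ℕ} : ∀ {P : PGen γ}, P.Adm K → T4CanonicalMenus.maxStep PEv.step P.toGen ≤ P.lastStep
  | PGen.birth j d z, _ => by simp [PGen.toGen, PGen.lastStep]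
  | PGen.renew G h, hA => by
      simp only [PGen.Adm] at hA
      have ih := maxStep_toGen_le hA.1
      simp only [PGen.toGen, PGen.lastStep, T4CanonicalMenus.maxStep_renew, PEv.step_mk, max_le_iff]
      omega
  | PGen.join X Y s, hA => by
      simp only [PGen.Adm] at hA
      have ihX := maxStep_toGen_le hA.1
      have ihY := maxStep_toGen_le hA.2.1
      simp only [PGen.toGen, PGen.lastStep, T4CanonicalMenus.maxStep_merge, PEv.step_mk, max_le_iff]
      omega

/-- **`Adm ∧ CanonJoins ⟹` THE CANONICAL RUN'S CHRONOLOGY** of the label. [folklore] -/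
theorem canonChrono_toGen {K : ℕ} : ∀ {P : PGen γ}, P.Adm K → CanonJoins P → T4CanonicalMenus.Chrono PEv.step P.toGen
  | PGen.birth j d z, _, _ => trivial
  | PGen.renew G h, hA, hC => by
      have hrl := PGen.Adm.rootStep_le_lastStep hA.1
      simp only [PGen.Adm] at hA
      have hm := maxStep_toGen_le hA.1
      refine (T4CanonicalMenus.chrono_renew_iff PEv.step _ _ _).2 ⟨canonChrono_toGen hA.1 hC, ?_, ?_⟩
      · simp only [PGen.rootStep_toGen, PEv.step_mk]; omega
      · simp only [PEv.step_mk]; omega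
  | PGen.join X Y s, hA, hC => by
      simp only [PGen.Adm] at hA
      obtain ⟨hCX, hCY, hle, hlt⟩ := hC
      have hmX := maxStep_toGen_le hA.1
      have hmY := maxStep_toGen_le hA.2.1
      refine (T4CanonicalMenus.chrono_merge_iff PEv.step _ _ _).2
        ⟨canonChrono_toGen hA.1 hCX, canonChrono_toGen hA.2.1 hCY, ?_, ?_, ?_, ?_⟩
      · simpa only [PGen.rootStep_toGen] using hle
      · simpa only [PGen.rootStep_toGen, PEv.step_mk] using hlt
      · simp only [PEv.step_mk]; omega
      · simp only [PEv.step_mk]; omega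

/-- conversely the canonical chronology of the label forces `CanonJoins` (no admissibility needed) [folklore] -/
theorem canonJoins_of_canonChrono : ∀ {P : PGen γ}, T4CanonicalMenus.Chrono PEv.step P.toGen → CanonJoins P
  | PGen.birth _ _ _, _ => trivial
  | PGen.renew G h, hc => canonJoins_of_canonChrono (P := G) hc.1
  | PGen.join X Y s, hc => by
      obtain ⟨hX, hY, hle, hlt, -, -⟩ := hc
      simp only [PGen.rootStep_toGen, PEv.step_mk] at hle hlt
      exact ⟨canonJoins_of_canonChrono hX, canonJoins_of_canonChrono hY, hle, hlt⟩

/-- **THE CHARACTERISATION**: for an admissible history, the label is chronological for the canonical run IFF its joins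
are canonically oriented and strict. [folklore] -/
theorem canonChrono_toGen_iff {K : ℕ} {P : PGen γ} (hA : P.Adm K) :
    T4CanonicalMenus.Chrono PEv.step P.toGen ↔ CanonJoins P :=
  ⟨canonJoins_of_canonChrono, canonChrono_toGen hA⟩

/-- **`StrictJoins P`** — orientation-free strictness: every join happens strictly after the EARLIEST birth among its
constituents (equivalently: at least one partner line is older than the join step). [folklore] -/
def StrictJoins : PGen γ → Prop
  | PGen.birth _ _ _ => True
  | PGen.renew G _ => StrictJoins G
  | PGen.join X Y s => StrictJoins X ∧ StrictJoins Y ∧ min X.rootStep Y.rootStep < s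

/-- `StrictJoins` is decidable [folklore] -/
instance StrictJoins.instDecidable : ∀ P : PGen γ, Decidable (StrictJoins P)
  | PGen.birth _ _ _ => isTrue trivial
  | PGen.renew G _ => StrictJoins.instDecidable G
  | PGen.join X Y s =>
      haveI := StrictJoins.instDecidable X
      haveI := StrictJoins.instDecidable Y
      inferInstanceAs (Decidable (StrictJoins X ∧ StrictJoins Y ∧ min X.rootStep Y.rootStep < s))

/-- canonical joins are strict [folklore] -/
theorem strictJoins_of_canonJoins : ∀ {P : PGen γ}, CanonJoins P → StrictJoins P
  | PGen.birth _ _ _, _ => trivial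
  | PGen.renew G _, h => strictJoins_of_canonJoins (P := G) h
  | PGen.join _ _ _, h => ⟨strictJoins_of_canonJoins h.1, strictJoins_of_canonJoins h.2.1,
      (min_le_left _ _).trans_lt h.2.2.2⟩

/-- **ORIENTATION**: swap the partners of every join so that the older line comes first (ties keep the order).
[folklore] -/
def orient : PGen γ → PGen γ
  | PGen.birth j d z => PGen.birth j d z
  | PGen.renew G h => PGen.renew (orient G) h
  | PGen.join X Y s => if X.rootStep ≤ Y.rootStep then PGen.join (orient X) (orient Y) s
      else PGen.join (orient Y) (orient X) s

/-- orientation keeps the root step [folklore] -/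
@[simp] theorem rootStep_orient : ∀ P : PGen γ, (orient P).rootStep = P.rootStep
  | PGen.birth j d z => rfl
  | PGen.renew G h => by simp [orient, PGen.rootStep, rootStep_orient G]
  | PGen.join X Y s => by
      unfold orient
      split_ifs with h
      · simp [PGen.rootStep, rootStep_orient X, rootStep_orient Y]
      · simp [PGen.rootStep, rootStep_orient X, rootStep_orient Y, min_comm]

/-- orientation keeps the last step [folklore] -/
@[simp] theorem lastStep_orient : ∀ P : PGen γ, (orient P).lastStep = P.lastStep
  | PGen.birth j d z => rfl
  | PGen.renew G h => rfl
  | PGen.join _ _ _ => by unfold orient; split_ifs <;> rfl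

/-- orientation keeps the event multiset (hence the label's event set and `TypeNodup`) [folklore] -/
theorem evTypes_orient : ∀ P : PGen γ, (orient P).evTypes = P.evTypes
  | PGen.birth j d z => rfl
  | PGen.renew G h => by simp [orient, PGen.evTypes, evTypes_orient G]
  | PGen.join X Y s => by
      unfold orient
      split_ifs
      · simp [PGen.evTypes, evTypes_orient X, evTypes_orient Y]
      · simp [PGen.evTypes, evTypes_orient X, evTypes_orient Y, add_comm]

/-- orientation keeps admissibility [folklore] -/
theorem adm_orient {K : ℕ} : ∀ {P : PGen γ}, P.Adm K → (orient P).Adm K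
  | PGen.birth j d z, h => h
  | PGen.renew G hh, h => by
      simp only [PGen.Adm] at h ⊢
      exact ⟨adm_orient h.1, by simpa using h.2.1, h.2.2⟩
  | PGen.join X Y s, h => by
      simp only [PGen.Adm] at h
      unfold orient
      split_ifs
      · exact ⟨adm_orient h.1, adm_orient h.2.1, by simpa using h.2.2.1, by simpa using h.2.2.2.1, h.2.2.2.2⟩
      · exact ⟨adm_orient h.2.1, adm_orient h.1, by simpa using h.2.2.2.1, by simpa using h.2.2.1, h.2.2.2.2⟩

/-- **ORIENTATION IS FREE, STRICTNESS IS THE CONDITION**: the oriented history has canonical joins iff the original has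
strict joins. [folklore] -/
theorem canonJoins_orient_iff : ∀ P : PGen γ, CanonJoins (orient P) ↔ StrictJoins P
  | PGen.birth j d z => by simp [orient, CanonJoins, StrictJoins]
  | PGen.renew G h => by simpa [orient, CanonJoins, StrictJoins] using canonJoins_orient_iff G
  | PGen.join X Y s => by
      have ihX := canonJoins_orient_iff X
      have ihY := canonJoins_orient_iff Y
      unfold orient
      split_ifs with h
      · simp only [CanonJoins, StrictJoins, rootStep_orient, ihX, ihY, min_eq_left h]
        tauto
      · simp only [CanonJoins, StrictJoins, rootStep_orient, ihX, ihY, min_eq_right (le_of_not_ge h)]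
        constructor
        · rintro ⟨hY, hX, -, hlt⟩; exact ⟨hX, hY, hlt⟩
        · rintro ⟨hX, hY, hlt⟩; exact ⟨hY, hX, le_of_not_ge h, hlt⟩

/-- **SO AN ADMISSIBLE HISTORY WITH STRICT JOINS HAS A CANONICALLY CHRONOLOGICAL (ORIENTED) LABEL.** [folklore] -/
theorem canonChrono_toGen_orient {K : ℕ} {P : PGen γ} (hA : P.Adm K) (hS : StrictJoins P) :
    T4CanonicalMenus.Chrono PEv.step (orient P).toGen :=
  canonChrono_toGen (adm_orient hA) ((canonJoins_orient_iff P).2 hS)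

end Skeleton

/-! ## §3 The located boundary, decided: a join at the common birth step -/

namespace Sanity

/-- the all-new m1 join at the common birth step (both regions born at `3`, joined by the operations of step `3`) is
admissible but has NO strict join, hence no orientation makes its label chronological for the canonical run — while
its label IS `ZoneSkeleton.Chrono` (`HistoryChronoAdmissible`, same example). [folklore] -/
theorem joinAtBirth_boundary :
    (PGen.join (PGen.birth 3 1 5) (PGen.birth 3 2 9) 3 : PGen ℕ).Adm 3 ∧
      ¬ StrictJoins (PGen.join (PGen.birth 3 1 5) (PGen.birth 3 2 9) 3 : PGen ℕ) ∧
      ¬ T4CanonicalMenus.Chrono PEv.step (PGen.join (PGen.birth 3 1 5) (PGen.birth 3 2 9) 3 : PGen ℕ).toGen ∧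
      ¬ T4CanonicalMenus.Chrono PEv.step (PGen.join (PGen.birth 3 2 9) (PGen.birth 3 1 5) 3 : PGen ℕ).toGen := by
  refine ⟨by simp only [PGen.Adm, PGen.lastStep, le_refl, and_self], by decide, ?_, ?_⟩ <;> decide

/-- the owner's decided history `hist` (class-1 region born at `0` joined at `3` by a class-2 region born at `2`,
renewed at `6`): older line first and strict — canonically chronological by `canonChrono_toGen`. [folklore] -/
theorem hist_canonChrono : T4CanonicalMenus.Chrono PEv.step PGen.Sanity.hist.toGen :=
  canonChrono_toGen PGen.Sanity.hist_adm (by decide)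

/-- … and the same history written with the YOUNGER line first is admissible, strict, NOT canonical — `orient` repairs
it. [folklore] -/
theorem hist_swapped :
    ¬ CanonJoins (PGen.renew (PGen.join (PGen.birth 2 2 9) (PGen.birth 0 1 5) 3) 6 : PGen ℕ) ∧
      CanonJoins (orient (PGen.renew (PGen.join (PGen.birth 2 2 9) (PGen.birth 0 1 5) 3) 6 : PGen ℕ)) :=
  ⟨by decide, (canonJoins_orient_iff _).2 (by decide)⟩

end Sanity

/-! ## §4 (v2) Through the shape map: the socket's `canon` field from the skeleton (ruling R-OWNER-22-7 (α)) -/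

section Shape

variable {ε γ : Type*}

/-- **THE TH SOCKET's CHRONOLOGY FIELD FROM THE SKELETON.**  If a tagged genealogy `G : Gen ε` with shape map
`sh : ε → PEv` has shape `relabel sh G = P.toGen` for an admissible history `P` with canonically oriented strict joins
(under the owner's booking (α) of R-OWNER-22-7 — all-new joins dated one step late — `StrictJoins` holds by
construction and `orient` supplies the orientation), then `G` is chronological for the canonical run read through `sh`:
the per-member hypothesis of `T4CanonicalMenus.mem_canonFam_of_chrono`. (Canonical chronology is invariant under
step-preserving relabelling, `T4CanonicalMenus.chrono_relabel_iff`.) [folklore] -/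
theorem canonChrono_of_shape {sh : ε → PEv} {G : Gen ε} {K : ℕ} {P : PGen γ} (hsh : relabel sh G = P.toGen)
    (hA : P.Adm K) (hC : CanonJoins P) : T4CanonicalMenus.Chrono (PEv.step ∘ sh) G :=
  (T4CanonicalMenus.chrono_relabel_iff sh (st := PEv.step ∘ sh) (st' := PEv.step) (fun _ => rfl) G).1
    (hsh ▸ canonChrono_toGen hA hC)

/-- … and conversely the shape's history must have canonical joins [folklore] -/
theorem canonJoins_of_shape {sh : ε → PEv} {G : Gen ε} {P : PGen γ} (hsh : relabel sh G = P.toGen)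
    (hc : T4CanonicalMenus.Chrono (PEv.step ∘ sh) G) : CanonJoins P :=
  canonJoins_of_canonChrono (hsh ▸ (T4CanonicalMenus.chrono_relabel_iff sh (st := PEv.step ∘ sh) (st' := PEv.step)
    (fun _ => rfl) G).2 hc)

/-- the zone side for the same member: `ZoneSkeleton.Chrono PEv.step` of the shape `relabel sh G` (= `P.toGen`), from
admissibility alone (`HistoryChronoAdmissible.chrono_toGen`) [folklore] -/
theorem chronoZ_of_shape {sh : ε → PEv} {G : Gen ε} {K : ℕ} {P : PGen γ} (hsh : relabel sh G = P.toGen)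
    (hA : P.Adm K) : Chrono PEv.step (relabel sh G) := by
  rw [hsh]; exact HistoryChronoAdmissible.chrono_toGen hA

end Shape

end Summit.QuantumFields.BalabanUV.T4Continuum.HistoryChronoCanon
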